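import Literature.MathematicalPhysics.QuantumLattice.HubbardFermiLiquid
import Literature.MathematicalPhysics.QuantumLattice.HubbardGaugeBound
import Literature.MathematicalPhysics.QuantumLattice.FermionQuasiFree
import HarnessLib

/-!
# BGM 2006 two-point fact: the spin selection rule and the reduction to equal spins

Sibling proof file of `Literature/MathematicalPhysics/QuantumLattice/HubbardFermiLiquid.lean`
(named fact `bgm_two_point_limit`, Benfatto–Giuliani–Mastropietro, Ann. Henri Poincaré 7 (2006)
809, Thm. 1.1). It PROVES, from the accepted definitions only:

* `gaugeMatrix_spin_mul_hamiltonianWith_mul`, `commute_gaugeMatrix_spin_hamiltonianWith` — the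
  grand-canonical Hubbard Hamiltonian `hamiltonianWith G t U μ` on ANY finite graph is invariant
  under the (non-unitary, Koma–Tasaki style) gauge transformation `exp[-Σ_{(x,σ)} f(σ) n_{xσ}]`
  generated by a potential depending on the SPIN only (separate conservation of `N_↑`, `N_↓`;
  BGM 2006 §2.1, symmetries (2)–(3) of the Grassmann action);
* `thermalCorr_creation_annihilation_of_ne` — the spin selection rule
  `⟨c†_{xσ} c_{yσ'}⟩_β = 0` for `σ ≠ σ'` in every finite volume (trace cyclicity: the gauge
  conjugation multiplies `c†_{xσ} c_{yσ'}` by `e^{f(σ') - f(σ)} ≠ 1` and fixes `e^{-βH}`);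
* `hubbardThermalTwoPoint_eq_zero_of_ne`, `tendsto_hubbardThermalTwoPoint_of_ne` — hence the
  spin-off-diagonal part of `bgm_two_point_limit` holds trivially (limit `0`), and
  `bgm_two_point_limit_iff_diag` reduces the fact to its equal-spin (`σ = σ'`) content, which is
  the equal-time value of BGM's two-point Schwinger function `S(x, σ, -; y, σ, +)` (loc. cit.
  eq. (1.2) with the equal-time ordering of footnote 1);
* `hubbardThermalTwoPoint_zero_interaction` — at `U = 0` the finite-volume two-point function
  is the Fermi matrix `[(1 + e^{βh_L})⁻¹]_{(y,σ'),(x,σ)}` of the torus one-body Hamiltonian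
  (the position-space, equal-time form of BGM's free propagator (1.4); from the quasi-free
  layer `FermionQuasiFree.lean`).

The equal-spin statement itself is NOT proved here: it is the `L → ∞` existence part of
BGM's Thm. 1.1, whose printed proof is the multiscale fermionic renormalisation group of
loc. cit. §§2–3 (Grassmann representation (2.6)–(2.8), determinant bounds and tree expansion
Thm. 2.1, sector counting Lemma A3.1, improved power counting (2.36) and flow control (2.71a)
under `U₀ |h_β| ≤ c₀`, i.e. `β ≤ e^{a/|U|}`), with the finite-`L` uniformity only sketched
(footnote 1 of §2.3, referring to Benfatto–Mastropietro, Rev. Math. Phys. 13 (2001) 1323).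
Of that machinery the tree so far has the free layer only (`FermionQuasiFree.lean`: imaginary-time
evolution of the fields, Fermi-matrix two-point function; `FermionQuasiFreeWick.lean`: the thermal
Wick theorem); the fact stays a cited named fact.

## Sources

* G. Benfatto, A. Giuliani, V. Mastropietro, *Fermi liquid behavior in the 2D Hubbard model at
  low temperatures*, Ann. Henri Poincaré 7 (2006) 809–898 (arXiv:cond-mat/0507686), Thm. 1.1,
  §2.1 (symmetries), footnote 1 of §1.2 (equal-time ordering).
* T. Koma, H. Tasaki, PRL 68 (1992) 3248, eqs. (5)–(8) (the gauge matrices, tree file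
  `HubbardGaugeBound.lean`).
-/

noncomputable section

open Filter Topology Matrix
open Literature.MathematicalPhysics.QuantumLattice Literature.Probability.LatticeModels

namespace Literature.MathematicalPhysics.QuantumLattice

/-! ### An abstract selection rule for traces -/

/-- **Selection rule.** If `P` commutes with the weight `W`, `P'` is a left inverse of `P`, and
conjugation by `P` rescales the observable `A` by a factor `c ≠ 1`, then `tr (W A) = 0`
(`tr (W A) = tr (P W A P') = c · tr (W A)`). [folklore] -/
theorem trace_weight_mul_eq_zero_of_conj_eq_smul {n : Type*} [Fintype n] [DecidableEq n]
    {P P' W A : Matrix n n ℂ} {c : ℂ} (hPW : Commute P W) (hP : P' * P = 1)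
    (hA : P * A * P' = c • A) (hc : c ≠ 1) : (W * A).trace = 0 := by
  have h1 : (W * A).trace = c * (W * A).trace := by
    calc (W * A).trace = (P' * P * (W * A)).trace := by rw [hP, Matrix.one_mul]
      _ = (P * (W * A) * P').trace := by rw [Matrix.mul_assoc, trace_mul_comm]
      _ = (W * (P * A * P')).trace := by
          rw [← Matrix.mul_assoc P W A, hPW.eq, Matrix.mul_assoc W P A,
            Matrix.mul_assoc W (P * A) P']
      _ = c * (W * A).trace := by rw [hA, Matrix.mul_smul, trace_smul, smul_eq_mul]
  have h2 : (1 - c) * (W * A).trace = 0 := by rw [sub_mul, one_mul, ← h1, sub_self]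
  rcases mul_eq_zero.1 h2 with h | h
  · exact absurd (sub_eq_zero.1 h).symm hc
  · exact h

/-! ### Spin-dependent gauge transformations -/

section SpinGauge

variable {Λ : Type*} [LinearOrder Λ] [Fintype Λ]

/-- Conjugating `c†_{uσ} c_{vσ'}` by the gauge transformation of a spin-only potential `f`
rescales it by `e^{-f(σ) + f(σ')}` (Koma–Tasaki eq. (8) for the orbital potential
`(x, σ) ↦ f σ`). Koma–Tasaki, PRL 68 (1992) 3248, eq. (8). [cite: KomaTasakiPRL1992, eq. (8)] -/
theorem gaugeMatrix_spin_mul_creation_mul_annihilation_mul (f : Fin 2 → ℝ) (u v : Λ)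
    (σ σ' : Fin 2) :
    gaugeMatrix (fun o : Orb Λ => f (ofLex o).2) * (creation (orb u σ) * annihilation (orb v σ')) *
        gaugeMatrix (-fun o : Orb Λ => f (ofLex o).2) =
      ((Real.exp (-f σ + f σ') : ℝ) : ℂ) • (creation (orb u σ) * annihilation (orb v σ')) := by
  rw [gaugeMatrix_conj_mul, gaugeMatrix_mul_creation_mul, gaugeMatrix_mul_annihilation_mul,
    smul_mul_smul, ← Complex.ofReal_mul, ← Real.exp_add]
  rfl

/-- Number operators are invariant under the spin gauge transformation.
Koma–Tasaki, PRL 68 (1992) 3248, eq. (7). [cite: KomaTasakiPRL1992, eq. (7)] -/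
theorem gaugeMatrix_spin_mul_numberOp_mul (f : Fin 2 → ℝ) (u : Λ) (σ : Fin 2) :
    gaugeMatrix (fun o : Orb Λ => f (ofLex o).2) * numberOp u σ *
        gaugeMatrix (-fun o : Orb Λ => f (ofLex o).2) = numberOp u σ := by
  rw [← numberAt_orb, gaugeMatrix_mul_numberAt_mul]

variable (G : SimpleGraph Λ) [DecidableRel G.Adj]

/-- Hopping operators are invariant under the spin gauge transformation (both ends of a hop carry
the same spin, so the factors `e^{-f(σ)}`, `e^{f(σ)}` cancel). BGM 2006 §2.1, symmetries (2)–(3).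
[cite: BenfattoGiulianiMastropietro2006, §2.1] -/
theorem gaugeMatrix_spin_mul_hoppingForm_mul (f : Fin 2 → ℝ) (w : Λ → Λ → ℝ) :
    gaugeMatrix (fun o : Orb Λ => f (ofLex o).2) * hoppingForm G w *
        gaugeMatrix (-fun o : Orb Λ => f (ofLex o).2) = hoppingForm G w := by
  simp only [hoppingForm, Finset.mul_sum, Finset.sum_mul]
  refine Finset.sum_congr rfl fun u _ => Finset.sum_congr rfl fun v _ =>
    Finset.sum_congr rfl fun σ _ => ?_
  split_ifs with h
  · rw [Matrix.mul_smul, Matrix.smul_mul, gaugeMatrix_spin_mul_creation_mul_annihilation_mul,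
      neg_add_cancel, Real.exp_zero, Complex.ofReal_one, one_smul]
  · rw [Matrix.mul_zero, Matrix.zero_mul]

/-- The density terms `U Σ n n - μ N` are invariant under the spin gauge transformation.
BGM 2006 §2.1, symmetries (2)–(3). [cite: BenfattoGiulianiMastropietro2006, §2.1] -/
theorem gaugeMatrix_spin_mul_densityTerms_mul (f : Fin 2 → ℝ) (U μ : ℝ) :
    gaugeMatrix (fun o : Orb Λ => f (ofLex o).2) * densityTerms U μ *
        gaugeMatrix (-fun o : Orb Λ => f (ofLex o).2) =
      (densityTerms U μ : Matrix (Finset (Orb Λ)) (Finset (Orb Λ)) ℂ) := by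
  unfold densityTerms totalNumber
  simp only [Matrix.mul_sub, Matrix.sub_mul, Matrix.mul_smul, Matrix.smul_mul, Finset.mul_sum,
    Finset.sum_mul, gaugeMatrix_conj_mul _ (numberOp _ 0), gaugeMatrix_spin_mul_numberOp_mul]

/-- **`U(1)_↑ × U(1)_↓` invariance.** The grand-canonical Hubbard Hamiltonian is invariant under
the gauge transformation of every spin-only potential: `G_f (H(t,U) - μN) G_f⁻¹ = H(t,U) - μN`.
BGM 2006 §2.1, symmetries (2)–(3). [cite: BenfattoGiulianiMastropietro2006, §2.1] -/
theorem gaugeMatrix_spin_mul_hamiltonianWith_mul (f : Fin 2 → ℝ) (t U μ : ℝ) :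
    gaugeMatrix (fun o : Orb Λ => f (ofLex o).2) * hamiltonianWith G t U μ *
        gaugeMatrix (-fun o : Orb Λ => f (ofLex o).2) = hamiltonianWith G t U μ := by
  rw [hamiltonianWith_eq_hoppingForm, Matrix.mul_add, Matrix.add_mul, Matrix.mul_smul,
    Matrix.smul_mul, gaugeMatrix_spin_mul_hoppingForm_mul, gaugeMatrix_spin_mul_densityTerms_mul]

/-- The spin gauge transformation commutes with the grand-canonical Hubbard Hamiltonian.
BGM 2006 §2.1, symmetries (2)–(3). [cite: BenfattoGiulianiMastropietro2006, §2.1] -/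
theorem commute_gaugeMatrix_spin_hamiltonianWith (f : Fin 2 → ℝ) (t U μ : ℝ) :
    Commute (gaugeMatrix fun o : Orb Λ => f (ofLex o).2) (hamiltonianWith G t U μ) := by
  have h := congrArg (· * gaugeMatrix (fun o : Orb Λ => f (ofLex o).2))
    (gaugeMatrix_spin_mul_hamiltonianWith_mul G f t U μ)
  simp only [Matrix.mul_assoc, gaugeMatrix_neg_mul_gaugeMatrix, Matrix.mul_one] at h
  exact h

/-- **Spin selection rule.** In the Gibbs state of the grand-canonical Hubbard Hamiltonian on any
finite graph, `⟨c†_{uσ} c_{vσ'}⟩_β = 0` whenever `σ ≠ σ'` (the observable changes `N_↑ - N_↓`,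
which `e^{-βH}` conserves). BGM 2006 §2.1, symmetries (2)–(3).
[cite: BenfattoGiulianiMastropietro2006, §2.1] -/
theorem thermalCorr_creation_annihilation_of_ne (β t U μ : ℝ) (u v : Λ) {σ σ' : Fin 2}
    (hσ : σ ≠ σ') :
    thermalCorr β (hamiltonianWith G t U μ) (creation (orb u σ)) (annihilation (orb v σ')) = 0 := by
  classical
  let f : Fin 2 → ℝ := fun τ => if τ = σ' then 1 else 0
  have hf : -f σ + f σ' = 1 := by simp [f, hσ]
  have hcomm : Commute (gaugeMatrix fun o : Orb Λ => f (ofLex o).2)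
      (gibbsWeight β (hamiltonianWith G t U μ)) :=
    ((commute_gaugeMatrix_spin_hamiltonianWith G f t U μ).smul_right (-(β : ℂ))).exp_right
  have hc : ((Real.exp (-f σ + f σ') : ℝ) : ℂ) ≠ 1 := by
    rw [hf, Ne, Complex.ofReal_eq_one]
    have h2 := Real.add_one_lt_exp (one_ne_zero (α := ℝ))
    intro h1
    linarith
  rw [thermalCorr, gibbsState_apply,
    trace_weight_mul_eq_zero_of_conj_eq_smul hcomm (gaugeMatrix_neg_mul_gaugeMatrix _)
      (gaugeMatrix_spin_mul_creation_mul_annihilation_mul f u v σ σ') hc, mul_zero]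

end SpinGauge

/-! ### Consequences for the BGM two-point fact -/

/-- The spin-off-diagonal finite-volume two-point functions of the 2D Hubbard torus vanish
identically: `⟨c†_{xσ} c_{yσ'}⟩_{β,L} = 0` for `σ ≠ σ'` and every `L`.
BGM 2006 §2.1, symmetries (2)–(3). [cite: BenfattoGiulianiMastropietro2006, §2.1] -/
theorem hubbardThermalTwoPoint_eq_zero_of_ne (β U μ : ℝ) (L : ℕ) (x y : Site 2) {σ σ' : Fin 2}
    (hσ : σ ≠ σ') : hubbardThermalTwoPoint β U μ L x y σ σ' = 0 := by
  unfold hubbardThermalTwoPoint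
  split_ifs with hL
  · rfl
  · -- `convert`, not `exact`: the `DecidableEq`/`Fintype` instances synthesised for the concrete
    -- torus differ syntactically from the generic ones (closed by `Subsingleton.elim`).
    haveI : NeZero L := ⟨hL⟩
    convert thermalCorr_creation_annihilation_of_ne (fermionTorusGraph 2 L) β 1 U μ
      (FermionTorus.ofTorusSite (Torus.proj L x)) (FermionTorus.ofTorusSite (Torus.proj L y)) hσ
      using 3
    rfl

/-- Hence the spin-off-diagonal part of `bgm_two_point_limit` holds trivially, with limit `0`,
for all parameters. BGM 2006 §2.1. [cite: BenfattoGiulianiMastropietro2006, §2.1] -/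
theorem tendsto_hubbardThermalTwoPoint_of_ne (β U μ : ℝ) (x y : Site 2) {σ σ' : Fin 2}
    (hσ : σ ≠ σ') :
    Tendsto (fun L : ℕ => hubbardThermalTwoPoint β U μ L x y σ σ') atTop (𝓝 0) := by
  simp only [hubbardThermalTwoPoint_eq_zero_of_ne β U μ _ x y hσ]
  exact tendsto_const_nhds

/-- **Reduction of the BGM fact to equal spins.** `bgm_two_point_limit` is equivalent to its
`σ = σ'` content: convergence, as `L → ∞`, of `⟨c†_{xσ} c_{yσ}⟩_{β,L}` — the equal-time value of
BGM's two-point Schwinger function `S(x,σ,-;y,σ,+)` of eq. (1.2) (equal-time ordering of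
footnote 1) — in the regime of Thm. 1.1. The off-diagonal components converge to `0` by the spin
selection rule. [cite: BenfattoGiulianiMastropietro2006, Thm. 1.1] -/
theorem bgm_two_point_limit_iff_diag :
    bgm_two_point_limit ↔
      ∀ μ : ℝ, -4 < μ → μ < -2 - Real.sqrt 2 → ∃ U₀ c : ℝ, 0 < U₀ ∧ 0 < c ∧
        ∀ U β : ℝ, U ≠ 0 → |U| ≤ U₀ → 0 < β → β ≤ Real.exp (c / |U|) →
          ∀ (x y : Site 2) (σ : Fin 2), ∃ S : ℂ,
            Tendsto (fun L : ℕ => hubbardThermalTwoPoint β U μ L x y σ σ) atTop (𝓝 S) := by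
  refine ⟨fun h μ h1 h2 => ?_, fun h μ h1 h2 => ?_⟩
  · obtain ⟨U₀, c, hU₀, hc, H⟩ := h μ h1 h2
    exact ⟨U₀, c, hU₀, hc, fun U β hU hUle hβ hβle x y σ => H U β hU hUle hβ hβle x y σ σ⟩
  · obtain ⟨U₀, c, hU₀, hc, H⟩ := h μ h1 h2
    refine ⟨U₀, c, hU₀, hc, fun U β hU hUle hβ hβle x y σ σ' => ?_⟩
    by_cases hσ : σ = σ'
    · subst hσ
      exact H U β hU hUle hβ hβle x y σ
    · exact ⟨0, tendsto_hubbardThermalTwoPoint_of_ne β U μ x y hσ⟩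

/-! ### The free (`U = 0`) two-point function: BGM's free propagator at equal times -/

/-- **The `U = 0` value of the fact's two-point function.** On every torus `(ℤ/Lℤ)²`, `L ≠ 0`,
the free finite-volume two-point function is the Fermi matrix of the torus one-body
Hamiltonian `h_L = hubbardOneBody (fermionTorusGraph 2 L) 1 μ` (`= -Δ_torus-adjacency - μ`):
`⟨c†_{xσ} c_{yσ'}⟩_{β,L,U=0} = [(1 + e^{β h_L})⁻¹]_{(y,σ'),(x,σ)}` — the position-space,
equal-time form of BGM's free propagator (1.4) in finite volume (its momentum-space form follows
by diagonalising `h_L` with the characters of `(ℤ/Lℤ)²`). This is the zeroth-order input of the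
expansion behind `bgm_two_point_limit` (BGM 2006 §2.1, `P(dψ)` with propagator `ĝ_𝐤`).
[cite: BenfattoGiulianiMastropietro2006, eq. (1.4)] -/
theorem hubbardThermalTwoPoint_zero_interaction (β μ : ℝ) (L : ℕ) [NeZero L] (x y : Site 2)
    (σ σ' : Fin 2) :
    hubbardThermalTwoPoint β 0 μ L x y σ σ' =
      (1 + NormedSpace.exp ((β : ℂ) • hubbardOneBody (fermionTorusGraph 2 L) 1 μ))⁻¹
        (orb (FermionTorus.ofTorusSite (Torus.proj L y)) σ')
        (orb (FermionTorus.ofTorusSite (Torus.proj L x)) σ) := by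
  unfold hubbardThermalTwoPoint
  rw [dif_neg (NeZero.ne L)]
  -- `convert`, not `exact`: instance terms for the concrete torus differ syntactically
  convert thermalCorr_hamiltonianWith_zero (fermionTorusGraph 2 L) β 1 μ
    (FermionTorus.ofTorusSite (Torus.proj L x)) (FermionTorus.ofTorusSite (Torus.proj L y)) σ σ'
    using 6
  rfl

end Literature.MathematicalPhysics.QuantumLattice
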